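import Summits.QuantumFields.BalabanUV.Beta.D1BFx.LogDetSecondVariation

/-!
# T-TEL (telescoping identity) line, helper 6 — THE ONE-LOOP FUNCTIONAL TELESCOPES OVER ALL SCALES along a background curve: if the one-shot
# determinants factor through the step determinants scale by scale (pointwise in the background), the second variations ADD UP

Helper for crux K2⁷ `EndpointGivenBR13SepCoPH` = stmt-QuantumFields-20543 (route `BalabanUVNodes`), seat `d1-tel-1` gen 0 (director-ym R576-ym (D)(2): T-TEL «for all L ≥ 2
and all scales j»).  Helpers 1–5 (`…SchurQuotient` p782298, `…SchurJets` p782375, `…SchurJetsCurves` p782412, `…SchurSymmetric` p782439, `…UnrolledRecursion` p782452)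
are the algebra of the EFFECTIVE FORMS (tree level) and the unrolled transport recursion.  T-TEL proper concerns the ONE-LOOP data: the background Hessians of
`log|det|` of the step systems versus that of the one-shot system (`HidentScalewise.HessianTelescoping` ∕ `OneStepKernelFamily.D1Tel` at kernel level; the typed step
kernel is `hessKer = ½·(tadpole − bubble)` = one half of `D1BFx.LogDetSecondVariation.secondVar` entrywise).  At matrix level the determinants telescope POINTWISE in
the background — helper 1's `det_three_levels`, the tree's `Literature…Beta.Composition.det_kkt_compForm` ∕ `Chain.logZ_total` (bordered), `CompositionSingular` — so
along any `C²` background curve the one-loop functionals add up scale by scale.  This file is that induction, in the tree's curve convention, with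
`LogDetSecondVariation.secondVar_comb_eq_zero` as the only engine.  [folklore]; 0 `def`, 0 `sorry`.

* `secondVar_eq_add_of_logAbsDet` — three `C²` matrix curves (any three finite index types), non-degenerate at `t`, with `log|det A| = log|det B| + log|det C| + c`
  near `t` ⟹ `secondVar A = secondVar B + secondVar C` at `t` (the one-step one-loop law: composite = previous one-shot + step).
* `secondVar_telescope` — a TOWER: one-shot curves `𝒦 m` (index types `N m`) and step curves `K j` (index types `n j`), all `C²` near `t` and non-degenerate at `t`,
  with the scale-by-scale factorisation `log|det 𝒦 (m+1)| = log|det 𝒦 m| + log|det K m| + c m` near `t` ⟹ for every `m`,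
  `secondVar (𝒦 m) = secondVar (𝒦 0) + Σ_{j<m} secondVar (K j)` at `t` — the one-loop jets TELESCOPE over all scales (the matrix shape of
  `HessianTelescopingKKT.hessianTelescoping_of_stepRecursion`; the transports sit inside the curves `K j`, which are functions of the TOP-level background).

HONEST FRAMING.  Finite-dimensional calculus; nothing of Bałaban's kernels asserted; the kernel-level dictionary (S3) of `Cruxes/EndpointGivenBR13SepCoPH/D1TelSignatures.lean`
is OPEN (LAYER 2, road «FP» route T); `D1Tel`, K2⁷, `BetaPertH` NOT proved; NOT continuum, NOT OS, NOT Clay; the Yang–Mills mass gap is NOT proved.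
-/

noncomputable section

namespace Summit.QuantumFields.YangMills.Theorems.BalabanUVNodesK2D1TelSecondVarTelescope

open Matrix Filter Finset
open scoped Topology
open Summit.QuantumFields.BalabanUV.Beta.D1BFx.LogDetSecondVariation (secondVar secondVar_comb_eq_zero)

/-- [folklore] **ONE STEP OF THE ONE-LOOP LAW along a curve**: three matrix curves `A`, `B`, `C` (finite index types `ι₁ ι₂ ι₃`), each with first derivatives near `t`,
a second derivative at `t` and `det ≠ 0` at `t`; if `log|det A| = log|det B| + log|det C| + c` on a neighbourhood of `t`, then
`secondVar A = secondVar B + secondVar C` at `t`. -/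
theorem secondVar_eq_add_of_logAbsDet {ι₁ ι₂ ι₃ : Type*} [Fintype ι₁] [DecidableEq ι₁] [Fintype ι₂] [DecidableEq ι₂] [Fintype ι₃] [DecidableEq ι₃]
    {A A₁ : ℝ → ι₁ → ι₁ → ℝ} {A₂ : Matrix ι₁ ι₁ ℝ} {B B₁ : ℝ → ι₂ → ι₂ → ℝ} {B₂ : Matrix ι₂ ι₂ ℝ} {C C₁ : ℝ → ι₃ → ι₃ → ℝ} {C₂ : Matrix ι₃ ι₃ ℝ}
    {t c : ℝ}
    (hA : ∀ᶠ u in 𝓝 t, HasDerivAt A (A₁ u) u) (hA₁ : HasDerivAt A₁ (A₂ : ι₁ → ι₁ → ℝ) t) (hdA : (Matrix.of (A t)).det ≠ 0)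
    (hB : ∀ᶠ u in 𝓝 t, HasDerivAt B (B₁ u) u) (hB₁ : HasDerivAt B₁ (B₂ : ι₂ → ι₂ → ℝ) t) (hdB : (Matrix.of (B t)).det ≠ 0)
    (hC : ∀ᶠ u in 𝓝 t, HasDerivAt C (C₁ u) u) (hC₁ : HasDerivAt C₁ (C₂ : ι₃ → ι₃ → ℝ) t) (hdC : (Matrix.of (C t)).det ≠ 0)
    (heq : ∀ᶠ u in 𝓝 t, Real.log |(Matrix.of (A u)).det| = Real.log |(Matrix.of (B u)).det| + Real.log |(Matrix.of (C u)).det| + c) :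
    secondVar (Matrix.of (A t)) (Matrix.of (A₁ t)) A₂
      = secondVar (Matrix.of (B t)) (Matrix.of (B₁ t)) B₂ + secondVar (Matrix.of (C t)) (Matrix.of (C₁ t)) C₂ := by
  have heq' : ∀ᶠ u in 𝓝 t, (1 : ℝ) * Real.log |(Matrix.of (A u)).det| + (-1) * Real.log |(Matrix.of (B u)).det|
      + (-1) * Real.log |(Matrix.of (C u)).det| + 0 * Real.log |(Matrix.of (A u)).det| = c := by
    filter_upwards [heq] with u hu
    rw [hu]
    ring
  have h := secondVar_comb_eq_zero hA hA₁ hdA hB hB₁ hdB hC hC₁ hdC hA hA₁ hdA heq'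
  linarith

/-- [folklore] **THE ONE-LOOP FUNCTIONAL TELESCOPES OVER ALL SCALES.**  A tower of one-shot curves `𝒦 m` (on index types `N m`) and step curves `K j` (on `n j`), all with
first derivatives near `t`, second derivatives at `t` and non-degenerate at `t`; if for every `m` the one-shot determinant of `m+1` steps factors, near `t`, through that
of `m` steps and the step-`m` determinant — `log|det 𝒦 (m+1)| = log|det 𝒦 m| + log|det K m| + c m` — then for every `m`
`secondVar (𝒦 m) = secondVar (𝒦 0) + Σ_{j<m} secondVar (K j)` at `t`. -/
theorem secondVar_telescope {N n : ℕ → Type*} [∀ m, Fintype (N m)] [∀ m, DecidableEq (N m)] [∀ j, Fintype (n j)] [∀ j, DecidableEq (n j)]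
    {𝒦 𝒦₁ : ∀ m : ℕ, ℝ → N m → N m → ℝ} {𝒦₂ : ∀ m : ℕ, Matrix (N m) (N m) ℝ}
    {K K₁ : ∀ j : ℕ, ℝ → n j → n j → ℝ} {K₂ : ∀ j : ℕ, Matrix (n j) (n j) ℝ} {t : ℝ} {c : ℕ → ℝ}
    (h𝒦 : ∀ m, ∀ᶠ u in 𝓝 t, HasDerivAt (𝒦 m) (𝒦₁ m u) u) (h𝒦₁ : ∀ m, HasDerivAt (𝒦₁ m) (𝒦₂ m : N m → N m → ℝ) t)
    (hd𝒦 : ∀ m, (Matrix.of (𝒦 m t)).det ≠ 0)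
    (hK : ∀ j, ∀ᶠ u in 𝓝 t, HasDerivAt (K j) (K₁ j u) u) (hK₁ : ∀ j, HasDerivAt (K₁ j) (K₂ j : n j → n j → ℝ) t)
    (hdK : ∀ j, (Matrix.of (K j t)).det ≠ 0)
    (hfac : ∀ m, ∀ᶠ u in 𝓝 t, Real.log |(Matrix.of (𝒦 (m + 1) u)).det|
      = Real.log |(Matrix.of (𝒦 m u)).det| + Real.log |(Matrix.of (K m u)).det| + c m) :
    ∀ m : ℕ, secondVar (Matrix.of (𝒦 m t)) (Matrix.of (𝒦₁ m t)) (𝒦₂ m)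
      = secondVar (Matrix.of (𝒦 0 t)) (Matrix.of (𝒦₁ 0 t)) (𝒦₂ 0) + ∑ j ∈ range m, secondVar (Matrix.of (K j t)) (Matrix.of (K₁ j t)) (K₂ j) := by
  intro m
  induction m with
  | zero => rw [sum_range_zero, add_zero]
  | succ m ih =>
    rw [secondVar_eq_add_of_logAbsDet (h𝒦 (m + 1)) (h𝒦₁ (m + 1)) (hd𝒦 (m + 1)) (h𝒦 m) (h𝒦₁ m) (hd𝒦 m) (hK m) (hK₁ m) (hdK m) (hfac m), ih,
      sum_range_succ, add_assoc]

end Summit.QuantumFields.YangMills.Theorems.BalabanUVNodesK2D1TelSecondVarTelescope
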